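import Summits.AtomisticToContinuum.FouriersLaw.Theses.EmbeddedDrudeMourre
import Literature.MathematicalPhysics.KineticTheory.ZeroWavenumberSpace
import Literature.MathematicalPhysics.KineticTheory.FluctuationSpaceStone
import Literature.MathematicalPhysics.KineticTheory.InfiniteChainInvariantStates
import Literature.MathematicalPhysics.KineticTheory.InfiniteChainSuperstableDynamics
import HarnessLib

/-!
# Stub C `stub_pencilDerivation`, part (iii): the local classes form a core of the Koopman generator
(line `gram-pencil-harmonic-chaos`, crux `EmbeddedDrudeMourre.DrudeDissolution`,
item stmt-AtomisticToContinuum-12593; `--supports` file, closes nothing)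

WHAT. The Engel–Nagel core lemma for the Stone generator `L` of the Koopman group `U_t` on Spohn's /
Doyon's fluctuation space (`FluctuationDynamics.generator`, any `FluctuationDynamics`): under strong
continuity, a DENSE subspace `S ⊆ D(L)` which is INVARIANT under every `U_t` is a core of `L`
(Mathlib's `LinearPMap.HasCore`: the closure of `L|S` is `L`) —
`FluctuationDynamics.IsStronglyContinuous.generator_hasCore`. Specialised to a zero-wavenumber datum `Z`
of `pinnedChain ω₂ lam β 1` whose observables are the flow-orbit of the local polynomials `𝒫`
(registered sub-goal `stub_pencilDerivation_core`): IF every polynomial class `[u]`, `u ∈ 𝒫`, is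
differentiable at `0` along the group (conjunct (ii-a) of stub C), THEN the span of the local classes
`{[w] : w ∈ Z.localObs}` is a core of `Z.generator` (conjunct (ii-b) of stub C).

PROOF (Engel–Nagel, One-parameter semigroups, Prop. II.1.7). `L` is closed (Stone, tree:
`generator_isClosed`), so `K := closure (graph L|S) ⊆ graph L`. Conversely, for `φ ∈ S` the pair
`(∫₀ᵗ U_s φ ds, U_t φ - φ) = ∫₀ᵗ (U_s φ, L U_s φ) ds` is an integral of a continuous `graph(L|S)`-valued
path, hence in `K`; by density of `S` and continuity of `φ ↦ (∫₀ᵗ U_s φ ds, U_t φ - φ)` the same holds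
for every `ψ`; for `ψ ∈ D(L)`, `t⁻¹ (∫₀ᵗ U_s ψ ds, U_t ψ - ψ) → (ψ, Lψ)` as `t → 0`, and `K` is closed.
-/

noncomputable section

open MeasureTheory Filter Set Function Topology
open scoped InnerProductSpace ENNReal
open Literature.MathematicalPhysics.KineticTheory
open Literature.MathematicalPhysics.KineticTheory.HeatConduction
open Literature.MathematicalPhysics.KineticTheory.PhononBoltzmann

namespace Summit.AtomisticToContinuum.FouriersLaw.Theorems.DrudeDissolution.GramPencilHarmonicChaos

section Abstract

variable {G Ω : Type*} [AddCommGroup G] [MeasurableSpace G] [MeasurableSpace Ω]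
  {ν : Measure G} {T : ShiftAction G Ω} {D : FluctuationDynamics ν T}
  [MeasurableNeg G] [ν.IsNegInvariant]

/-- The regularising map `ψ ↦ ∫₀ᵗ U_s ψ ds` is continuous (it is linear of norm `≤ |t|`). [folklore] -/
theorem continuous_koopmanIntegral (hU : D.IsStronglyContinuous) (t : ℝ) :
    Continuous fun ψ : D.FluctuationSpace => D.koopmanIntegral t ψ := by
  have hint : ∀ ψ : D.FluctuationSpace, IntervalIntegrable (fun s : ℝ => D.koopman s ψ) volume 0 t :=
    fun ψ => hU.intervalIntegrable_koopman ψ 0 t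
  let Φ : D.FluctuationSpace →ₗ[ℝ] D.FluctuationSpace :=
    { toFun := fun ψ => D.koopmanIntegral t ψ
      map_add' := fun ψ φ => by
        simp only [FluctuationDynamics.koopmanIntegral_def, map_add]
        exact intervalIntegral.integral_add (hint ψ) (hint φ)
      map_smul' := fun r ψ => by
        simp only [FluctuationDynamics.koopmanIntegral_def, LinearIsometryEquiv.map_smul,
          RingHom.id_apply]
        exact intervalIntegral.integral_smul r _ }
  have hb : ∀ ψ, ‖Φ ψ‖ ≤ |t| * ‖ψ‖ := by
    intro ψ
    have h : ‖∫ s in (0 : ℝ)..t, D.koopman s ψ‖ ≤ ‖ψ‖ * |t - 0| :=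
      intervalIntegral.norm_integral_le_of_norm_le_const fun s _ => ((D.koopman s).norm_map ψ).le
    rw [sub_zero, mul_comm] at h
    exact h
  exact (Φ.mkContinuous |t| hb).continuous

/-- **Engel–Nagel's core lemma for the Koopman generator**: under strong continuity, a dense
subspace `S` of the domain of the generator which is invariant under the group is a CORE
(the closure of `L|S` is `L`). [cite: EngelNagel2000, Ch. II Prop. 1.7] -/
theorem _root_.Literature.MathematicalPhysics.KineticTheory.FluctuationDynamics.IsStronglyContinuous.generator_hasCore
    (hU : D.IsStronglyContinuous) (S : Submodule ℝ D.FluctuationSpace)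
    (hSd : Dense (S : Set D.FluctuationSpace)) (hSdom : S ≤ D.generatorDomain)
    (hSinv : ∀ (t : ℝ), ∀ ψ ∈ S, D.koopman t ψ ∈ S) : D.generator.HasCore S := by
  set L := D.generator with hL
  have hLS_le : L.domRestrict S ≤ L := LinearPMap.domRestrict_le
  have hLclosed : L.IsClosed := hU.generator_isClosed
  have hLSclosable : (L.domRestrict S).IsClosable := hLclosed.isClosable.leIsClosable hLS_le
  set K : Submodule ℝ (D.FluctuationSpace × D.FluctuationSpace) :=
    (L.domRestrict S).graph.topologicalClosure with hK
  have hKclosed : IsClosed (K : Set (D.FluctuationSpace × D.FluctuationSpace)) :=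
    Submodule.isClosed_topologicalClosure _
  haveI : CompleteSpace K := hKclosed.completeSpace_coe
  have hK_le : K ≤ L.graph :=
    Submodule.topologicalClosure_minimal _ (LinearPMap.le_graph_of_le hLS_le) hLclosed
  -- Step A: for `φ ∈ S`, `(∫₀ᵗ U_s φ ds, U_t φ - φ) ∈ K`.
  have stepA : ∀ φ ∈ S, ∀ t : ℝ, (D.koopmanIntegral t φ, D.koopman t φ - φ) ∈ K := by
    intro φ hφ t
    have hφd : φ ∈ D.generatorDomain := hSdom hφ
    -- the graph-valued path
    have hmem : ∀ s : ℝ, (D.koopman s φ, D.koopman s (L ⟨φ, hφd⟩)) ∈ K := by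
      intro s
      refine Submodule.le_topologicalClosure _ ?_
      rw [LinearPMap.mem_graph_iff]
      have hs : D.koopman s φ ∈ S ⊓ L.domain := ⟨hSinv s φ hφ, D.koopman_mem_generatorDomain hφd s⟩
      refine ⟨⟨D.koopman s φ, by rw [LinearPMap.domRestrict_domain]; exact hs⟩, rfl, ?_⟩
      rw [LinearPMap.domRestrict_apply (y := ⟨D.koopman s φ, D.koopman_mem_generatorDomain hφd s⟩) rfl]
      exact D.generator_koopman hφd s
    set g : ℝ → K := fun s => ⟨(D.koopman s φ, D.koopman s (L ⟨φ, hφd⟩)), hmem s⟩ with hg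
    have hgc : Continuous g :=
      ((hU φ).prodMk (hU _)).subtype_mk _
    have hint := (K.subtypeL).intervalIntegral_comp_comm (hgc.intervalIntegrable (μ := volume) 0 t)
    -- `∫ K.subtypeL (g s) = K.subtypeL (∫ g)`; the left side is `(∫ U_s φ, ∫ U_s Lφ)`.
    have h1 : (∫ s in (0 : ℝ)..t, K.subtypeL (g s)) =
        (D.koopmanIntegral t φ, D.koopman t φ - φ) := by
      have e1 : (fun s => K.subtypeL (g s)) = fun s => (D.koopman s φ, D.koopman s (L ⟨φ, hφd⟩)) := by
        funext s; rfl
      rw [e1]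
      have hi1 : IntervalIntegrable (fun s : ℝ => D.koopman s φ) volume 0 t :=
        hU.intervalIntegrable_koopman φ 0 t
      have hi2 : IntervalIntegrable (fun s : ℝ => D.koopman s (L ⟨φ, hφd⟩)) volume 0 t :=
        hU.intervalIntegrable_koopman _ 0 t
      simp only [intervalIntegral, integral_pair hi1.1 hi2.1, integral_pair hi1.2 hi2.2, Prod.mk_sub_mk]
      rw [hU.koopman_sub_eq_integral hφd t, FluctuationDynamics.koopmanIntegral_def]
      rfl
    rw [← h1, hint]
    exact (∫ s in (0 : ℝ)..t, g s).2
  -- Step B: by density the same holds for every `ψ`.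
  have stepB : ∀ (ψ : D.FluctuationSpace) (t : ℝ), (D.koopmanIntegral t ψ, D.koopman t ψ - ψ) ∈ K := by
    intro ψ t
    have hc : Continuous fun ψ : D.FluctuationSpace => (D.koopmanIntegral t ψ, D.koopman t ψ - ψ) :=
      (continuous_koopmanIntegral hU t).prodMk ((D.koopman t).continuous.sub continuous_id)
    have hcl : IsClosed {ψ : D.FluctuationSpace | (D.koopmanIntegral t ψ, D.koopman t ψ - ψ) ∈ K} :=
      hKclosed.preimage hc
    have hsub : (S : Set D.FluctuationSpace) ⊆
        {ψ : D.FluctuationSpace | (D.koopmanIntegral t ψ, D.koopman t ψ - ψ) ∈ K} :=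
      fun φ hφ => stepA φ hφ t
    have huniv := hSd.mono hsub
    have hset : {ψ : D.FluctuationSpace | (D.koopmanIntegral t ψ, D.koopman t ψ - ψ) ∈ K} = Set.univ :=
      hcl.closure_eq.symm.trans huniv.closure_eq
    have hψ : ψ ∈ (Set.univ : Set D.FluctuationSpace) := Set.mem_univ ψ
    rw [← hset] at hψ
    exact hψ
  -- Step C: for `ψ ∈ D(L)`, `t⁻¹ (∫₀ᵗ U_s ψ ds, U_t ψ - ψ) → (ψ, Lψ)`, so `(ψ, Lψ) ∈ K`.
  have stepC : L.graph ≤ K := by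
    intro x hx
    rw [LinearPMap.mem_graph_iff] at hx
    obtain ⟨ψ, h1, h2⟩ := hx
    have hψ : (ψ : D.FluctuationSpace) ∈ D.generatorDomain := ψ.2
    have ht1 := hU.tendsto_inv_smul_koopmanIntegral (ψ : D.FluctuationSpace)
    have ht2 : Tendsto (fun t : ℝ => t⁻¹ • (D.koopman t (ψ : D.FluctuationSpace) - ψ)) (𝓝[≠] 0)
        (𝓝 (L ψ)) := by
      have h := (D.hasDerivAt_koopman ψ).tendsto_slope_zero
      simp only [FluctuationDynamics.koopman_zero_apply, zero_add] at h
      exact h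
    have ht := ht1.prodMk_nhds ht2
    have hmem : ∀ᶠ t : ℝ in 𝓝[≠] 0, (t⁻¹ • D.koopmanIntegral t (ψ : D.FluctuationSpace),
        t⁻¹ • (D.koopman t (ψ : D.FluctuationSpace) - ψ)) ∈ K := by
      refine Eventually.of_forall fun t => ?_
      have h := K.smul_mem t⁻¹ (stepB ψ t)
      simpa using h
    have hlim := hKclosed.mem_of_tendsto ht hmem
    have hxeq : x = ((ψ : D.FluctuationSpace), L ψ) := Prod.ext h1.symm h2.symm
    rw [hxeq]
    exact hlim
  refine ⟨hSdom, ?_⟩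
  apply LinearPMap.eq_of_eq_graph
  rw [← hLSclosable.graph_closure_eq_closure_graph]
  exact le_antisymm hK_le stepC

end Abstract


/-! ## The zero-wavenumber datum of the pencil: local classes are a core -/

/-- **Stub C, conjunct (ii-b) from (ii-a)** (registered sub-goal `stub_pencilDerivation_core`): for a
zero-wavenumber datum `Z` of `pinnedChain ω₂ lam β 1` over a dynamics which is the identity off
`bmGood = D.carrier`, with strongly continuous Koopman group and observables the flow-orbit of the local
polynomials `𝒫`: if `t ↦ U_t [u]` is differentiable at `0` with derivative `[liouvilleZ P u]` for every
`u ∈ 𝒫`, then the span of the local classes `[w]`, `w ∈ Z.localObs`, is a core of the generator.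
[cite: EngelNagel2000, Ch. II Prop. 1.7] -/
theorem stub_pencilDerivation_core : ∀ ω₂ lam β : ℝ, ∀ (D : Literature.MathematicalPhysics.KineticTheory.HeatConduction.InfiniteChainDynamics (Literature.MathematicalPhysics.KineticTheory.HeatConduction.pinnedChain ω₂ lam β 1)) (Z : Literature.MathematicalPhysics.KineticTheory.HeatConduction.ZeroWavenumberData (Literature.MathematicalPhysics.KineticTheory.HeatConduction.pinnedChain ω₂ lam β 1) D), D.carrier = (Literature.MathematicalPhysics.KineticTheory.HeatConduction.pinnedChain ω₂ lam β 1).bmGood → (∀ (t : ℝ) (σ : Literature.MathematicalPhysics.KineticTheory.HeatConduction.ChainConfig), σ ∉ (Literature.MathematicalPhysics.KineticTheory.HeatConduction.pinnedChain ω₂ lam β 1).bmGood → D.flow t σ = σ) → Z.toFluctuationDynamics.IsStronglyContinuous → Z.localObs = Submodule.span ℝ {w : Literature.MathematicalPhysics.KineticTheory.HeatConduction.ChainConfig → ℝ | ∃ u ∈ Algebra.adjoin ℝ (Set.range fun xc : ℤ × Bool => fun σ : Literature.MathematicalPhysics.KineticTheory.HeatConduction.ChainConfig => if xc.2 then (σ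 xc.1).2 else (σ xc.1).1), ∃ s : ℝ, w = u ∘ D.flow s} → (∀ u ∈ Algebra.adjoin ℝ (Set.range fun xc : ℤ × Bool => fun σ : Literature.MathematicalPhysics.KineticTheory.HeatConduction.ChainConfig => if xc.2 then (σ xc.1).2 else (σ xc.1).1), HasDerivAt (fun t : ℝ => (Z.koopman t (Z.fluct u) : Literature.MathematicalPhysics.KineticTheory.HeatConduction.ZeroWavenumberSpace Z)) (Z.fluct (Literature.MathematicalPhysics.KineticTheory.HeatConduction.liouvilleZ (Literature.MathematicalPhysics.KineticTheory.HeatConduction.pinnedChain ω₂ lam β 1) u)) 0) → Z.generator.HasCore (Submodule.span ℝ {ψ : Literature.MathematicalPhysics.KineticTheory.HeatConduction.ZeroWavenumberSpace Z | ∃ w ∈ Z.localObs, ψ = Z.fluct w}) := by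
  intro ω₂ lam β D Z hcar hoff hU hloc hder
  -- `φ_0 = id` everywhere (on the carrier by `flow_zero`, off it by the normal form)
  have hflow0 : D.flow 0 = id := by
    funext σ
    by_cases hσ : σ ∈ (pinnedChain ω₂ lam β 1).bmGood
    · exact D.flow_zero σ (by rw [hcar]; exact hσ)
    · exact hoff 0 σ hσ
  have hPsub : ∀ u ∈ Algebra.adjoin ℝ (Set.range fun xc : ℤ × Bool => fun σ : ChainConfig => if xc.2 then (σ xc.1).2 else (σ xc.1).1), u ∈ Z.localObs := by
    intro u hu
    rw [hloc]
    refine Submodule.subset_span ⟨u, hu, 0, ?_⟩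
    rw [hflow0]
    rfl
  set S : Submodule ℝ (ZeroWavenumberSpace Z) :=
    Submodule.span ℝ {ψ : ZeroWavenumberSpace Z | ∃ w ∈ Z.localObs, ψ = Z.fluct w} with hS
  -- the local classes lie in the domain of the generator
  have hdom : S ≤ Z.toFluctuationDynamics.generatorDomain := by
    rw [hS, Submodule.span_le]
    rintro ψ ⟨w, hw, rfl⟩
    have hw' := hw
    rw [hloc] at hw'
    clear hw
    induction hw' using Submodule.span_induction with
    | mem w hw0 =>
      obtain ⟨u, hu, s, rfl⟩ := hw0
      rw [SetLike.mem_coe, ← Z.koopman_fluct s (hPsub u hu)]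
      exact Z.toFluctuationDynamics.koopman_mem_generatorDomain (hder u hu).differentiableAt s
    | zero =>
      rw [SetLike.mem_coe, FluctuationStructure.fluct_zero]
      exact Submodule.zero_mem _
    | add x y hx hy hx' hy' =>
      have hxl : x ∈ Z.localObs := by rw [hloc]; exact hx
      have hyl : y ∈ Z.localObs := by rw [hloc]; exact hy
      rw [SetLike.mem_coe, FluctuationStructure.fluct_add hxl hyl]
      exact Submodule.add_mem _ hx' hy'
    | smul r x hx hx' =>
      have hxl : x ∈ Z.localObs := by rw [hloc]; exact hx
      rw [SetLike.mem_coe, FluctuationStructure.fluct_smul r hxl]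
      exact Submodule.smul_mem _ r hx'
  -- they are dense
  have hdense : Dense (S : Set (ZeroWavenumberSpace Z)) := by
    refine (FluctuationStructure.dense_range_fluct (F := Z.toFluctuationStructure)).mono ?_
    rintro ψ ⟨a, rfl⟩
    exact Submodule.subset_span ⟨a, a.2, rfl⟩
  -- and invariant under the group
  have hinv : ∀ t : ℝ, ∀ ψ ∈ S, Z.koopman t ψ ∈ S := by
    intro t ψ hψ
    induction hψ using Submodule.span_induction with
    | mem ψ h0 =>
      obtain ⟨w, hw, rfl⟩ := h0
      rw [Z.koopman_fluct t hw]
      exact Submodule.subset_span ⟨w ∘ D.flow t, Z.comp_flow_mem t hw, rfl⟩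
    | zero => rw [map_zero]; exact Submodule.zero_mem _
    | add x y _ _ hx hy => rw [map_add]; exact Submodule.add_mem _ hx hy
    | smul r x _ hx => rw [LinearIsometryEquiv.map_smul]; exact Submodule.smul_mem _ r hx
  exact hU.generator_hasCore S hdense hdom hinv

end Summit.AtomisticToContinuum.FouriersLaw.Theorems.DrudeDissolution.GramPencilHarmonicChaos

end
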